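import Literature.MathematicalPhysics.QuantumFieldTheory.MullerSchiemann1987.MS87RecursionCoefficients
import HarnessLib

/-!
# Müller–Schiemann, *Continuum limit of a hierarchical SU(2) lattice gauge theory in 4 dimensions*
# (CMP 110, 1987), Sect. 6 p.278 L.27–29: «within the weak coupling domain considered, i.e. β ≧ β̲ (large enough)
# and |λβ^{−1}|, |σβ^{−1}| bounded by constants, the transformation (6.2) has a unique inverse» — THE UNIQUENESS
# HALF: (6.2) `(β, λ, σ) ↦ (β̂, λ̂, σ̂)` IS INJECTIVE on the weak-coupling domain, with an explicit threshold
# `β̲ > 2 + 29Λ + 18Λ²` — PROVED (theorems only; no definition, no named fact)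

statement-level skeleton of published theorems with citation tags; proofs where landed; nothing here is a claim about the Yang–Mills mass gap

[MullerSchiemann1987] V. F. Müller, J. Schiemann, Commun. Math. Phys. **110** (1987) 261–286, Sect. 6 p.278, (6.2)–(6.3).
Read by this seat on its own 3× page render of the journal scan (`renders-cmp110ms/`, p.278 = PDF 18). Lean lane of
the lit-balaban YM LIT SWEEP CONTEXT row X1 (register `MullerSchiemann1987/`); the model is the `d = 4` HIERARCHICAL
`SU(2)` gauge model (Migdal's recursion), NOT lattice Yang–Mills. Sibling of `MS87RecursionCoefficients`, which
DEFINES the map (6.2) (`RecursionCoefficients.hatβ`, `hatlam`; `σ̂ = σ`) and certifies the printed inverse (6.3) to its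
printed order, declaring «of (6.3) the existence and uniqueness of the inverse MAP on the domain (an implicit-function
statement) — NOT claimed». THIS FILE PROVES THE UNIQUENESS HALF of that statement.

**What the paper prints (p.278).** *«In order to control the flow under repeated application of these recursions we
first diagonalize partially by suitable nonlinear transformations. In the case of r = 2 they are defined by
β̂ := β + (5/3)λβ^{−1} − (5/27)λβ^{−2} − (31/9)λ²β^{−3} + (35/9)σβ^{−2}, λ̂ := λ + 7/270 − (11/3)λ²β^{−2} + (14/3)σβ^{−1},
σ̂ := σ, (6.2) and similar definitions for β̂′, λ̂′, σ̂′. … We observe that within the weak coupling domain considered,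
i.e. β ≧ β̲ (large enough) and |λβ^{−1}|, |σβ^{−1}| bounded by constants, the transformation (6.2) has a unique inverse,
β = β̂ − (5/3)λ̂β̂^{−1} + 𝒪(β̂^{−1}), λ = λ̂ − 7/270 + (11/3)λ̂²β̂^{−2} − (14/3)σ̂β̂^{−1} + 𝒪(β̂^{−1}), σ = σ̂. (6.3)»*

**What this file proves (kernel-checked, 0 sorry, standard axioms; theorems only, no definition, no named fact).**
On the weak-coupling domain `𝒟(β̲, Λ) = {(β, λ, σ) : β ≥ β̲, |λ| ≤ Λβ, |σ| ≤ Λβ}` with `β̲ ≥ 1` and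
**`β̲ > 2 + 29Λ + 18Λ²`**, the map (6.2) is injective: `(β̂, λ̂, σ̂)(β₁, λ₁, σ₁) = (β̂, λ̂, σ̂)(β₂, λ₂, σ₂)` implies
`(β₁, λ₁, σ₁) = (β₂, λ₂, σ₂)` (`eq62_injective`; of the `σ`-bounds only the one at the first point is used). Route (a perturbation of the identity, by hand): with `uᵢ = λᵢ/βᵢ`
(`|uᵢ| ≤ Λ`), `Δλ = λ₁ − λ₂`, `Δβ = β₁ − β₂`, `Δu = u₁ − u₂ = (Δλ − u₂Δβ)/β₁`, the two equalities read
`Δλ = (11/3)Δu(u₁ + u₂) + (14/3)σΔβ/(β₁β₂)` and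
`Δβ = −(5/3)Δu + (5/27)(u₁/β₁ − u₂/β₂) + (31/9)(u₁²/β₁ − u₂²/β₂) − (35/9)σ(β₁^{−2} − β₂^{−2})`, whence
`|Δλ| + |Δβ| ≤ (2 + 29Λ + 18Λ²)(|Δλ| + |Δβ|)/β̲` (`core_estimate`), so both vanish.

**Readings / scope (declared).** (i) Only UNIQUENESS (injectivity) of (6.2) on the domain; EXISTENCE of the inverse on a
comparable domain (the other half of «has a unique inverse», a fixed-point / implicit-function statement) is NOT
formalised here. (ii) The threshold `2 + 29Λ + 18Λ²` is a crude explicit «β̲ large enough», not optimal. (iii) The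
`r = 4` analogue of (6.2) (printed only as `β̂ = β + 2λβ^{−1} + 𝒪(β^{−1})`) is not addressed.

**Not claimed.** Existence of the inverse map, (6.3) beyond the sibling's certification, Proposition 2, Theorem 1,
anything about lattice Yang–Mills or the Clay problem.
-/

namespace Literature.MathematicalPhysics.QuantumFieldTheory

namespace MullerSchiemann1987

namespace DecouplingMapInjective

open RecursionCoefficients (hatβ hatlam)

/-! ## §1 Elementary difference identities and bounds on the domain -/

/-- `|a/b| ≤ A/b₀` from `|a| ≤ A`, `0 < b₀ ≤ b`. [folklore] -/
private theorem abs_div_le {a b A b₀ : ℝ} (ha : |a| ≤ A) (hb₀ : 0 < b₀) (hb : b₀ ≤ b) : |a / b| ≤ A / b₀ := by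
  have hb' : 0 < b := lt_of_lt_of_le hb₀ hb
  rw [abs_div, abs_of_pos hb']
  exact div_le_div₀ ((abs_nonneg a).trans ha) ha hb₀ hb

/-- **THE CORE ESTIMATE** in the variables `uᵢ = λᵢ/βᵢ`: on the domain (`βᵢ ≥ β̲ ≥ 1`, `|uᵢ| ≤ Λ`, `|σ| ≤ Λβ₁` — the
bound at one of the two points suffices) the two equalities `λ̂₁ = λ̂₂`, `β̂₁ = β̂₂` of (6.2), written as the displayed difference identities, force
`|Δλ| + |Δβ| ≤ (2 + 29Λ + 18Λ²)(|Δλ| + |Δβ|)/β̲`. [cite: MullerSchiemann1987, (6.2)–(6.3) p.278] -/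
theorem core_estimate {β₁ β₂ u₁ u₂ s β₀ Λ : ℝ} (hβ₀ : 1 ≤ β₀) (h₁ : β₀ ≤ β₁) (h₂ : β₀ ≤ β₂)
    (hu₁ : |u₁| ≤ Λ) (hu₂ : |u₂| ≤ Λ) (hs₁ : |s| ≤ Λ * β₁)
    (hL : u₁ * β₁ - u₂ * β₂ = 11 / 3 * (u₁ ^ 2 - u₂ ^ 2) - 14 / 3 * s * (1 / β₁ - 1 / β₂))
    (hB : β₁ - β₂ = -(5 / 3) * (u₁ - u₂) + 5 / 27 * (u₁ / β₁ - u₂ / β₂) + 31 / 9 * (u₁ ^ 2 / β₁ - u₂ ^ 2 / β₂)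
      - 35 / 9 * s * (1 / β₁ ^ 2 - 1 / β₂ ^ 2)) :
    |u₁ * β₁ - u₂ * β₂| + |β₁ - β₂| ≤
      (2 + 29 * Λ + 18 * Λ ^ 2) * (|u₁ * β₁ - u₂ * β₂| + |β₁ - β₂|) / β₀ := by
  have hβ₀0 : 0 < β₀ := by linarith
  have hb₁ : 0 < β₁ := by linarith
  have hb₂ : 0 < β₂ := by linarith
  have hΛ : 0 ≤ Λ := (abs_nonneg _).trans hu₁
  -- denominators: `β̲ ≤ β₁β₂`, `β̲ ≤ β₂²` (as `βᵢ ≥ β̲ ≥ 1`)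
  have h12 : β₀ ≤ β₁ * β₂ := h₁.trans (le_mul_of_one_le_right hb₁.le (by linarith))
  have h22 : β₀ ≤ β₂ ^ 2 := by
    rw [sq]; exact h₂.trans (le_mul_of_one_le_right hb₂.le (by linarith))
  set X := |u₁ * β₁ - u₂ * β₂| with hX
  set Y := |β₁ - β₂| with hY
  have hX0 : 0 ≤ X := abs_nonneg _
  have hY0 : 0 ≤ Y := abs_nonneg _
  -- `Δu = (Δλ − u₂Δβ)/β₁`, `|Δu| ≤ (X + ΛY)/β̲`
  have dU : u₁ - u₂ = ((u₁ * β₁ - u₂ * β₂) - u₂ * (β₁ - β₂)) / β₁ := by field_simp; ring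
  have aU : |u₁ - u₂| ≤ (X + Λ * Y) / β₀ := by
    rw [dU]
    refine abs_div_le ?_ hβ₀0 h₁
    calc |(u₁ * β₁ - u₂ * β₂) - u₂ * (β₁ - β₂)| ≤ |u₁ * β₁ - u₂ * β₂| + |u₂ * (β₁ - β₂)| := abs_sub _ _
      _ ≤ X + Λ * Y := by rw [abs_mul]; exact add_le_add le_rfl (mul_le_mul_of_nonneg_right hu₂ (abs_nonneg _))
  have hU0 : 0 ≤ |u₁ - u₂| := abs_nonneg _
  -- the terms of (L)
  have tL1 : |11 / 3 * (u₁ ^ 2 - u₂ ^ 2)| ≤ 22 / 3 * Λ * |u₁ - u₂| := by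
    rw [show u₁ ^ 2 - u₂ ^ 2 = (u₁ - u₂) * (u₁ + u₂) by ring, abs_mul, abs_mul,
      abs_of_pos (by norm_num : (0:ℝ) < 11 / 3)]
    have h2 : |u₁ + u₂| ≤ 2 * Λ := (abs_add_le _ _).trans (by linarith)
    have := mul_le_mul_of_nonneg_left h2 hU0
    linarith
  have tL2 : |14 / 3 * s * (1 / β₁ - 1 / β₂)| ≤ 14 / 3 * Λ * Y / β₀ := by
    have e : 14 / 3 * s * (1 / β₁ - 1 / β₂) = 14 / 3 * (s / β₁) * ((β₂ - β₁) / β₂) := by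
      field_simp
    rw [e, abs_mul, abs_mul, abs_of_pos (by norm_num : (0:ℝ) < 14 / 3)]
    have a1 : |s / β₁| ≤ Λ := by
      rw [abs_div, abs_of_pos hb₁, div_le_iff₀ hb₁]; exact hs₁
    have a2 : |(β₂ - β₁) / β₂| ≤ Y / β₀ := abs_div_le (by rw [abs_sub_comm]) hβ₀0 h₂
    calc 14 / 3 * |s / β₁| * |(β₂ - β₁) / β₂| ≤ 14 / 3 * Λ * (Y / β₀) :=
          mul_le_mul (mul_le_mul_of_nonneg_left a1 (by norm_num)) a2 (abs_nonneg _) (by positivity)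
      _ = _ := by ring
  have hXb : X ≤ 22 / 3 * Λ * |u₁ - u₂| + 14 / 3 * Λ * Y / β₀ := by
    rw [hX, hL]; exact (abs_sub _ _).trans (add_le_add tL1 tL2)
  -- the terms of (B)
  have tB1 : |-(5 / 3) * (u₁ - u₂)| = 5 / 3 * |u₁ - u₂| := by
    rw [abs_mul, abs_neg, abs_of_pos (by norm_num : (0:ℝ) < 5 / 3)]
  have tB2 : |5 / 27 * (u₁ / β₁ - u₂ / β₂)| ≤ 5 / 27 * (|u₁ - u₂| + Λ * Y / β₀) := by
    rw [abs_mul, abs_of_pos (by norm_num : (0:ℝ) < 5 / 27)]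
    refine mul_le_mul_of_nonneg_left ?_ (by norm_num)
    have e : u₁ / β₁ - u₂ / β₂ = (u₁ - u₂) / β₁ + u₂ * ((β₂ - β₁) / (β₁ * β₂)) := by field_simp; ring
    rw [e]
    refine (abs_add_le _ _).trans (add_le_add ?_ ?_)
    · have := abs_div_le (le_rfl : |u₁ - u₂| ≤ |u₁ - u₂|) hβ₀0 h₁
      exact this.trans (div_le_self hU0 hβ₀)
    · rw [abs_mul]
      have a2 : |(β₂ - β₁) / (β₁ * β₂)| ≤ Y / β₀ := abs_div_le (by rw [abs_sub_comm]) hβ₀0 h12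
      calc |u₂| * |(β₂ - β₁) / (β₁ * β₂)| ≤ Λ * (Y / β₀) := mul_le_mul hu₂ a2 (abs_nonneg _) hΛ
        _ = _ := by ring
  have tB3 : |31 / 9 * (u₁ ^ 2 / β₁ - u₂ ^ 2 / β₂)| ≤ 31 / 9 * (2 * Λ * |u₁ - u₂| + Λ ^ 2 * Y / β₀) := by
    rw [abs_mul, abs_of_pos (by norm_num : (0:ℝ) < 31 / 9)]
    refine mul_le_mul_of_nonneg_left ?_ (by norm_num)
    have e : u₁ ^ 2 / β₁ - u₂ ^ 2 / β₂ = (u₁ - u₂) * (u₁ + u₂) / β₁ + u₂ ^ 2 * ((β₂ - β₁) / (β₁ * β₂)) := by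
      field_simp; ring
    rw [e]
    refine (abs_add_le _ _).trans (add_le_add ?_ ?_)
    · have hnum : |(u₁ - u₂) * (u₁ + u₂)| ≤ 2 * Λ * |u₁ - u₂| := by
        rw [abs_mul]
        have h2 : |u₁ + u₂| ≤ 2 * Λ := (abs_add_le _ _).trans (by linarith)
        have := mul_le_mul_of_nonneg_left h2 hU0
        linarith
      have := abs_div_le hnum hβ₀0 h₁
      exact this.trans (div_le_self (by positivity) hβ₀)
    · rw [abs_mul, abs_pow, sq_abs]
      have a2 : |(β₂ - β₁) / (β₁ * β₂)| ≤ Y / β₀ := abs_div_le (by rw [abs_sub_comm]) hβ₀0 h12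
      have hu2sq : u₂ ^ 2 ≤ Λ ^ 2 := sq_le_sq' (abs_le.mp hu₂).1 (abs_le.mp hu₂).2
      calc u₂ ^ 2 * |(β₂ - β₁) / (β₁ * β₂)| ≤ Λ ^ 2 * (Y / β₀) := mul_le_mul hu2sq a2 (abs_nonneg _) (sq_nonneg _)
        _ = _ := by ring
  have tB4 : |35 / 9 * s * (1 / β₁ ^ 2 - 1 / β₂ ^ 2)| ≤ 70 / 9 * Λ * Y / β₀ := by
    have e : 35 / 9 * s * (1 / β₁ ^ 2 - 1 / β₂ ^ 2) =
        35 / 9 * (s / β₁) * ((β₂ - β₁) / β₂ ^ 2 + (β₂ - β₁) / (β₁ * β₂)) := by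
      field_simp; ring
    rw [e, abs_mul, abs_mul, abs_of_pos (by norm_num : (0:ℝ) < 35 / 9)]
    have a1 : |s / β₁| ≤ Λ := by
      rw [abs_div, abs_of_pos hb₁, div_le_iff₀ hb₁]; exact hs₁
    have a2 : |(β₂ - β₁) / β₂ ^ 2 + (β₂ - β₁) / (β₁ * β₂)| ≤ 2 * (Y / β₀) := by
      refine (abs_add_le _ _).trans ?_
      have b1 : |(β₂ - β₁) / β₂ ^ 2| ≤ Y / β₀ := abs_div_le (by rw [abs_sub_comm]) hβ₀0 h22
      have b2 : |(β₂ - β₁) / (β₁ * β₂)| ≤ Y / β₀ := abs_div_le (by rw [abs_sub_comm]) hβ₀0 h12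
      linarith
    calc 35 / 9 * |s / β₁| * |(β₂ - β₁) / β₂ ^ 2 + (β₂ - β₁) / (β₁ * β₂)| ≤ 35 / 9 * Λ * (2 * (Y / β₀)) :=
          mul_le_mul (mul_le_mul_of_nonneg_left a1 (by norm_num)) a2 (abs_nonneg _) (by positivity)
      _ = _ := by ring
  have hYb : Y ≤ 5 / 3 * |u₁ - u₂| + 5 / 27 * (|u₁ - u₂| + Λ * Y / β₀) +
      31 / 9 * (2 * Λ * |u₁ - u₂| + Λ ^ 2 * Y / β₀) + 70 / 9 * Λ * Y / β₀ := by
    rw [hY]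
    conv_lhs => rw [hB]
    refine (abs_sub _ _).trans ?_
    refine (add_le_add ((abs_add_le _ _).trans (add_le_add ((abs_add_le _ _).trans (add_le_add le_rfl tB2)) tB3)) tB4).trans ?_
    rw [tB1]
  -- assemble
  have hK : X + Y ≤ (50 / 27 + 128 / 9 * Λ) * |u₁ - u₂| + (14 / 3 * Λ + 215 / 27 * Λ + 31 / 9 * Λ ^ 2) * Y / β₀ := by
    have e : (14 / 3 * Λ + 215 / 27 * Λ + 31 / 9 * Λ ^ 2) * Y / β₀ =
        14 / 3 * Λ * Y / β₀ + 5 / 27 * (Λ * Y / β₀) + 31 / 9 * (Λ ^ 2 * Y / β₀) + 70 / 9 * Λ * Y / β₀ := by ring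
    rw [e]; linarith
  have hk₁ : 0 ≤ 50 / 27 + 128 / 9 * Λ := by positivity
  have step : (50 / 27 + 128 / 9 * Λ) * |u₁ - u₂| ≤ (50 / 27 + 128 / 9 * Λ) * ((X + Λ * Y) / β₀) :=
    mul_le_mul_of_nonneg_left aU hk₁
  have e2 : (50 / 27 + 128 / 9 * Λ) * ((X + Λ * Y) / β₀) + (14 / 3 * Λ + 215 / 27 * Λ + 31 / 9 * Λ ^ 2) * Y / β₀ =
      ((50 / 27 + 128 / 9 * Λ) * X + (391 / 27 * Λ + 159 / 9 * Λ ^ 2) * Y) / β₀ := by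
    field_simp
    ring
  have hfin : X + Y ≤ ((50 / 27 + 128 / 9 * Λ) * X + (391 / 27 * Λ + 159 / 9 * Λ ^ 2) * Y) / β₀ := by
    rw [← e2]; linarith
  refine hfin.trans (div_le_div_of_nonneg_right ?_ hβ₀0.le)
  have p1 := mul_nonneg hΛ hX0
  have p2 := mul_nonneg hΛ hY0
  have p3 := mul_nonneg (sq_nonneg Λ) hX0
  have p4 := mul_nonneg (sq_nonneg Λ) hY0
  linarith

/-! ## §2 (6.2) is injective on the weak-coupling domain -/

/-- (6.2) in the variable `u = λ/β`: `λ̂(β, uβ, σ) = uβ + 7/270 − (11/3)u² + (14/3)σ/β`.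
[cite: MullerSchiemann1987, (6.2) p.278] -/
theorem hatlam_of_mul {β : ℝ} (hβ : β ≠ 0) (u σ : ℝ) :
    hatlam β (u * β) σ = u * β + 7 / 270 - 11 / 3 * u ^ 2 + 14 / 3 * σ / β := by
  simp only [hatlam]
  field_simp

/-- (6.2) in the variable `u = λ/β`: `β̂(β, uβ, σ) = β + (5/3)u − (5/27)u/β − (31/9)u²/β + (35/9)σ/β²`.
[cite: MullerSchiemann1987, (6.2) p.278] -/
theorem hatβ_of_mul {β : ℝ} (hβ : β ≠ 0) (u σ : ℝ) :
    hatβ β (u * β) σ = β + 5 / 3 * u - 5 / 27 * u / β - 31 / 9 * u ^ 2 / β + 35 / 9 * σ / β ^ 2 := by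
  simp only [hatβ]
  field_simp

/-- **(6.2) HAS AT MOST ONE PREIMAGE IN THE WEAK-COUPLING DOMAIN** («the transformation (6.2) has a unique inverse»,
uniqueness half): if `βᵢ ≥ β̲ ≥ 1`, `|λᵢ| ≤ Λβᵢ` (`i = 1, 2`), `|σ₁| ≤ Λβ₁` (the bound on `σ₂` is not needed),
`β̲ > 2 + 29Λ + 18Λ²`, and `β̂(β₁, λ₁, σ₁) = β̂(β₂, λ₂, σ₂)`, `λ̂(β₁, λ₁, σ₁) = λ̂(β₂, λ₂, σ₂)`, `σ̂₁ = σ̂₂` (i.e. `σ₁ = σ₂`),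
then `β₁ = β₂`, `λ₁ = λ₂`, `σ₁ = σ₂`. [cite: MullerSchiemann1987, (6.2)–(6.3) p.278] -/
theorem eq62_injective {β₁ β₂ lam₁ lam₂ σ₁ σ₂ β₀ Λ : ℝ} (hβ₀ : 1 ≤ β₀) (hlarge : 2 + 29 * Λ + 18 * Λ ^ 2 < β₀)
    (h₁ : β₀ ≤ β₁) (h₂ : β₀ ≤ β₂) (hl₁ : |lam₁| ≤ Λ * β₁) (hl₂ : |lam₂| ≤ Λ * β₂) (hs₁ : |σ₁| ≤ Λ * β₁)
    (hhatβ : hatβ β₁ lam₁ σ₁ = hatβ β₂ lam₂ σ₂) (hhatlam : hatlam β₁ lam₁ σ₁ = hatlam β₂ lam₂ σ₂)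
    (hhatσ : σ₁ = σ₂) :
    β₁ = β₂ ∧ lam₁ = lam₂ ∧ σ₁ = σ₂ := by
  subst hhatσ
  have hβ₀0 : 0 < β₀ := by linarith
  have hb₁ : 0 < β₁ := by linarith
  have hb₂ : 0 < β₂ := by linarith
  -- pass to `uᵢ = λᵢ/βᵢ`
  set u₁ := lam₁ / β₁ with hu₁d
  set u₂ := lam₂ / β₂ with hu₂d
  have el₁ : lam₁ = u₁ * β₁ := by rw [hu₁d]; field_simp
  have el₂ : lam₂ = u₂ * β₂ := by rw [hu₂d]; field_simp
  have hu₁ : |u₁| ≤ Λ := by rw [hu₁d, abs_div, abs_of_pos hb₁, div_le_iff₀ hb₁]; exact hl₁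
  have hu₂ : |u₂| ≤ Λ := by rw [hu₂d, abs_div, abs_of_pos hb₂, div_le_iff₀ hb₂]; exact hl₂
  -- the two equalities as difference identities in the variables `uᵢ`
  have hL : u₁ * β₁ - u₂ * β₂ = 11 / 3 * (u₁ ^ 2 - u₂ ^ 2) - 14 / 3 * σ₁ * (1 / β₁ - 1 / β₂) := by
    have h := hhatlam
    rw [el₁, el₂, hatlam_of_mul hb₁.ne', hatlam_of_mul hb₂.ne'] at h
    linear_combination h
  have hB : β₁ - β₂ = -(5 / 3) * (u₁ - u₂) + 5 / 27 * (u₁ / β₁ - u₂ / β₂) + 31 / 9 * (u₁ ^ 2 / β₁ - u₂ ^ 2 / β₂)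
      - 35 / 9 * σ₁ * (1 / β₁ ^ 2 - 1 / β₂ ^ 2) := by
    have h := hhatβ
    rw [el₁, el₂, hatβ_of_mul hb₁.ne', hatβ_of_mul hb₂.ne'] at h
    linear_combination h
  have hcore := core_estimate hβ₀ h₁ h₂ hu₁ hu₂ hs₁ hL hB
  -- `S ≤ K S/β̲` with `K < β̲` forces `S = 0`
  set S := |u₁ * β₁ - u₂ * β₂| + |β₁ - β₂| with hS
  have hS0 : 0 ≤ S := add_nonneg (abs_nonneg _) (abs_nonneg _)
  have hK0 : 0 ≤ 2 + 29 * Λ + 18 * Λ ^ 2 := by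
    have hΛ : 0 ≤ Λ := (abs_nonneg _).trans hu₁
    positivity
  have hS' : S * β₀ ≤ (2 + 29 * Λ + 18 * Λ ^ 2) * S := by
    have := (le_div_iff₀ hβ₀0).mp hcore
    linarith
  have hSz : S = 0 := by
    by_contra hne
    have hSpos : 0 < S := lt_of_le_of_ne hS0 (Ne.symm hne)
    have : S * β₀ > (2 + 29 * Λ + 18 * Λ ^ 2) * S := by nlinarith
    linarith
  have hDl : |u₁ * β₁ - u₂ * β₂| = 0 := by linarith [abs_nonneg (u₁ * β₁ - u₂ * β₂), abs_nonneg (β₁ - β₂)]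
  have hDb : |β₁ - β₂| = 0 := by linarith [abs_nonneg (u₁ * β₁ - u₂ * β₂), abs_nonneg (β₁ - β₂)]
  rw [abs_eq_zero, sub_eq_zero] at hDl
  rw [abs_eq_zero, sub_eq_zero] at hDb
  refine ⟨hDb, ?_, rfl⟩
  rw [el₁, el₂]; exact hDl

end DecouplingMapInjective

end MullerSchiemann1987

end Literature.MathematicalPhysics.QuantumFieldTheory
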